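import Mathlib
import HarnessLib
import Summits.HubbardSuperconductivity.HubbardSuperconductivity.Theorems.KLProgrammePerturbedFermiCurveGaussMapTorus
import Summits.HubbardSuperconductivity.HubbardSuperconductivity.Theorems.KLProgrammeKLRegimeSplitPredicates

/-!
# Route `KLProgramme` — ENGINE child (stmt-HubbardSuperconductivity-20437 `KLRegimeEngineV17F2`): the Gauss-map rate of an ADMISSIBLE frame's level curves
# under `FrameOK R U N μ K`, with a constant INDEPENDENT of the number of pieces `N` — brick 0 of the `TwoShellFrameAreaAt` witness
# (design note HOME/hubbard-kl-k3c2-p2/TWO-SHELL-FRAME-PORT.md §1–§2)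

Cell `gate-hubbard-kl`, seat hubbard-kl-k3c2-p2 g15; capstone over `…FrameHessBridge` (p605458) and `…GaussMapTorus`.  `TwoShellFrameAreaAt` quantifies over
EVERY `N`, so only N-UNIFORM consequences of `FrameOK R U N μ K` may be used: clause (ii) gives the C⁰/C¹ sizes of `δ_K = −K.eval` geometrically in the piece
index (orders 0, 1; order 2 is linear in `N`, cf. `norm_iteratedFDeriv_frameShift_le_of_frameOK`), clause (i) gives `GeomConstants (frameLevel μ K) 7 (3/80) (1/2) (3/200)`.
* §1 N-uniform sizes: `norm_iteratedFDeriv_zero_frameShift_le_of_frameOK` (`|δ_K| ≤ (4/3)·Gfr₀·|U|` on `Momentum`), `abs_negEval_le_of_frameOK`,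
  `norm_fderiv_negEval_le_of_frameOK` (`‖Dδ_K‖ ≤ (8/3)·Gfr₁·U²` on `Fin 2 → ℝ`) — p4's binders `hδ`, `hκ` with `κ₀ = (4/3)Gfr₀|U|`, `κ₁ = (8/3)Gfr₁U²`;
* §2 **`deriv_normalAngleFn_ge_of_frameOK`**, **`normalAngleFn_expand_of_frameOK`**, **`torusDist_normalAngleFn_sub_ge_of_frameOK`** — for the canonical root
  selection `u = perturbedFermiRadius δ_K ν` of the level-`(ν − μ)` curve of `e_K` (`|ν − μ| < 3/80`, `[ν − κ₀, ν + κ₀] ⊂ [a, b]`, `κ₁ < Dt_min` of a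
  `B : BandBounds a b`): `α′ ≥ c_K := u_min·(3/200)/(4 + (8/3)Gfr₁U²)` and `c_K·‖θ − θ′‖ ≤ ‖α(θ) − α(θ′)‖` on the line and on the torus — the
  `BandBounds.gauss` field of EVERY admissible frame's thin-shell level curves, uniformly in `N` and in the frame.
Everything is PROVED; no definitions, no named facts; nothing asserts any stub or superconductivity.
References: BGM 2006 §2.4 Lemma 2.1 (2.36)–(2.41) [cite: BenfattoGiulianiMastropietro2006]; FST II Lemma 2.1 [cite: FeldmanSalmhoferTrubowitz1998].
-/

noncomputable section

namespace Summit.HubbardSuperconductivity.HubbardSuperconductivity.Theorems.PerturbedFermiCurve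

set_option linter.dupNamespace false -- summit = problem name (single-conjunct summit), D-0017

open Real Set Finset
open Literature.MathematicalPhysics.QuantumLattice Literature.MathematicalPhysics.QuantumLattice.BandSectorCounting
open Literature.MathematicalPhysics.QuantumLattice.FermiRG
open Summit.HubbardSuperconductivity.HubbardSuperconductivity.Theorems.DispersionFlow
open Summit.HubbardSuperconductivity.HubbardSuperconductivity.Theorems.KLRegimeSplit

/-! ## §1 The N-uniform C⁰/C¹ sizes of an admissible frame -/

/-- **The ORDER-0 size of an admissible frame is `O(|U|)` uniformly in `N`**: `‖D⁰(frameShift K)(p)‖ ≤ (4/3)·Gfr₀·|U|` (pieces `Gfr₀·|U|·4^{−2n}`).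
[cite: BenfattoGiulianiMastropietro2006, §2.4 (2.36)] -/
theorem norm_iteratedFDeriv_zero_frameShift_le_of_frameOK {R : RenConsts} (hR : ∀ j, 0 ≤ R.Gfr j) {U : ℝ} {N : ℕ} {μ : ℝ}
    {K : TrigPolyC4v} (hK : FrameOK R U N μ K) (p : Momentum) :
    ‖iteratedFDeriv ℝ 0 (frameShift K) p‖ ≤ 4 / 3 * R.Gfr 0 * |U| := by
  obtain ⟨-, Kp, hsum, hS⟩ := hK
  have hfs : frameShift K = fun q => ∑ n ∈ range (N + 1), (fun q => -evalM (Kp n) q) q := by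
    funext q
    simp only [frameShift, evalM, hsum (WithLp.ofLp q), Finset.sum_neg_distrib]
  have hD : ‖iteratedFDeriv ℝ 0 (frameShift K) p‖ ≤ ∑ n ∈ range (N + 1), R.Gfr 0 * |U| * ((4 : ℝ) ^ n)⁻¹ := by
    rw [hfs, iteratedFDeriv_fun_sum_apply fun n _ => ((contDiff_evalM (Kp n)).neg).contDiffAt]
    refine (norm_sum_le _ _).trans (sum_le_sum fun n hn => ?_)
    have hn' : n ≤ N := Nat.lt_succ_iff.mp (mem_range.mp hn)
    have h := hS n hn' 0 (by norm_num) p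
    rw [show (fun q => -evalM (Kp n) q) = -evalM (Kp n) from rfl, iteratedFDeriv_neg_apply, norm_neg]
    refine h.trans ?_
    rw [uPow, if_pos rfl, show (((0 : ℕ) : ℤ) - 2) * (n : ℤ) = -((2 * n : ℕ) : ℤ) by push_cast; ring, zpow_neg, zpow_natCast]
    have h4 : ((4 : ℝ) ^ (2 * n))⁻¹ ≤ ((4 : ℝ) ^ n)⁻¹ := by
      refine inv_anti₀ (by positivity) ?_
      exact pow_le_pow_right₀ (by norm_num) (by omega)
    exact mul_le_mul_of_nonneg_left h4 (mul_nonneg (hR 0) (abs_nonneg U))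
  refine hD.trans ?_
  rw [← mul_sum]
  have hgeo : ∑ n ∈ range (N + 1), ((4 : ℝ) ^ n)⁻¹ ≤ 4 / 3 := by
    have h := geom_sum_Ico_le_of_lt_one (show (0 : ℝ) ≤ 1 / 4 by norm_num) (show (1 : ℝ) / 4 < 1 by norm_num) (m := 0) (n := N + 1)
    have e : ∑ n ∈ range (N + 1), ((4 : ℝ) ^ n)⁻¹ = ∑ i ∈ Ico 0 (N + 1), (1 / 4 : ℝ) ^ i := by
      rw [range_eq_Ico]; refine sum_congr rfl fun i _ => ?_; rw [one_div, inv_pow]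
    rw [e]; refine h.trans ?_; norm_num
  calc R.Gfr 0 * |U| * ∑ n ∈ range (N + 1), ((4 : ℝ) ^ n)⁻¹ ≤ R.Gfr 0 * |U| * (4 / 3) :=
        mul_le_mul_of_nonneg_left hgeo (mul_nonneg (hR 0) (abs_nonneg U))
    _ = 4 / 3 * R.Gfr 0 * |U| := by ring

/-- **`|δ_K(k)| ≤ (4/3)·Gfr₀·|U|`** on `Fin 2 → ℝ` (p4's binder `hδ` with `κ₀ = (4/3)Gfr₀|U|`, N-uniform). [cite: BenfattoGiulianiMastropietro2006, §2.4 (2.36)] -/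
theorem abs_negEval_le_of_frameOK {R : RenConsts} (hR : ∀ j, 0 ≤ R.Gfr j) {U : ℝ} {N : ℕ} {μ : ℝ} {K : TrigPolyC4v} (hK : FrameOK R U N μ K)
    (k : Fin 2 → ℝ) : |(fun k : Fin 2 → ℝ => -K.eval k) k| ≤ 4 / 3 * R.Gfr 0 * |U| := by
  have h := norm_iteratedFDeriv_zero_frameShift_le_of_frameOK hR hK (WithLp.toLp 2 k)
  rw [norm_iteratedFDeriv_zero, Real.norm_eq_abs, frameShift_toLp] at h
  exact h

/-- **`‖Dδ_K(k)‖ ≤ (8/3)·Gfr₁·U²`** on `Fin 2 → ℝ` (p4's binder `hκ` with `κ₁ = (8/3)Gfr₁U²`, N-uniform: the order-1 pieces `Gfr₁·U²·4^{−n}` sum to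
`≤ (4/3)Gfr₁U²` on `Momentum` — cf. `KLRegimeSplit.norm_iteratedFDeriv_one_frameShift_le_of_frameOK` — and `‖toLp‖ ≤ 2`).
[cite: BenfattoGiulianiMastropietro2006, §2.4 (2.36)] -/
theorem norm_fderiv_negEval_le_of_frameOK {R : RenConsts} (hR : ∀ j, 0 ≤ R.Gfr j) {U : ℝ} {N : ℕ} {μ : ℝ} {K : TrigPolyC4v}
    (hK : FrameOK R U N μ K) (k : Fin 2 → ℝ) : ‖fderiv ℝ (fun k : Fin 2 → ℝ => -K.eval k) k‖ ≤ 8 / 3 * R.Gfr 1 * U ^ 2 := by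
  set T := ((EuclideanSpace.equiv (Fin 2) ℝ).symm : (Fin 2 → ℝ) →L[ℝ] Momentum) with hT
  -- the order-1 size on `Momentum`, geometric in the piece index
  have hA : ∀ p : Momentum, ‖iteratedFDeriv ℝ 1 (frameShift K) p‖ ≤ 4 / 3 * R.Gfr 1 * U ^ 2 := by
    intro p
    obtain ⟨-, Kp, hsum, hS⟩ := hK
    have hfs : frameShift K = fun q => ∑ n ∈ range (N + 1), (fun q => -evalM (Kp n) q) q := by
      funext q
      simp only [frameShift, evalM, hsum (WithLp.ofLp q), Finset.sum_neg_distrib]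
    have hD : ‖iteratedFDeriv ℝ 1 (frameShift K) p‖ ≤ ∑ n ∈ range (N + 1), R.Gfr 1 * U ^ 2 * ((4 : ℝ) ^ n)⁻¹ := by
      rw [hfs, iteratedFDeriv_fun_sum_apply fun n _ => ((contDiff_evalM (Kp n)).neg).contDiffAt]
      refine (norm_sum_le _ _).trans (sum_le_sum fun n hn => ?_)
      have hn' : n ≤ N := Nat.lt_succ_iff.mp (mem_range.mp hn)
      have h := hS n hn' 1 (by norm_num) p
      rw [show (fun q => -evalM (Kp n) q) = -evalM (Kp n) from rfl, iteratedFDeriv_neg_apply, norm_neg]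
      refine h.trans (le_of_eq ?_)
      rw [uPow, if_neg one_ne_zero, show (((1 : ℕ) : ℤ) - 2) * (n : ℤ) = -(n : ℤ) by ring, zpow_neg, zpow_natCast]
    refine hD.trans ?_
    rw [← mul_sum]
    have hgeo : ∑ n ∈ range (N + 1), ((4 : ℝ) ^ n)⁻¹ ≤ 4 / 3 := by
      have h := geom_sum_Ico_le_of_lt_one (show (0 : ℝ) ≤ 1 / 4 by norm_num) (show (1 : ℝ) / 4 < 1 by norm_num) (m := 0) (n := N + 1)
      have e : ∑ n ∈ range (N + 1), ((4 : ℝ) ^ n)⁻¹ = ∑ i ∈ Ico 0 (N + 1), (1 / 4 : ℝ) ^ i := by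
        rw [range_eq_Ico]; refine sum_congr rfl fun i _ => ?_; rw [one_div, inv_pow]
      rw [e]; refine h.trans ?_; norm_num
    calc R.Gfr 1 * U ^ 2 * ∑ n ∈ range (N + 1), ((4 : ℝ) ^ n)⁻¹ ≤ R.Gfr 1 * U ^ 2 * (4 / 3) :=
          mul_le_mul_of_nonneg_left hgeo (mul_nonneg (hR 1) (sq_nonneg U))
      _ = 4 / 3 * R.Gfr 1 * U ^ 2 := by ring
  have hC : ContDiff ℝ 1 (frameShift K) := contDiff_frameShift K
  have hfun : (fun k : Fin 2 → ℝ => -K.eval k) = frameShift K ∘ T := by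
    rw [← frameShift_toLp_eq_comp]; funext k; simp only [frameShift_toLp]
  rw [← norm_iteratedFDeriv_one, hfun, ContinuousLinearMap.iteratedFDeriv_comp_right T hC k le_rfl]
  have h1 := ContinuousMultilinearMap.norm_compContinuousLinearMap_le (iteratedFDeriv ℝ 1 (frameShift K) (T k)) (fun _ : Fin 1 => T)
  have hA0 : 0 ≤ 4 / 3 * R.Gfr 1 * U ^ 2 := by have := hR 1; positivity
  calc _ ≤ ‖iteratedFDeriv ℝ 1 (frameShift K) (T k)‖ * ∏ _i : Fin 1, ‖T‖ := h1
    _ ≤ 4 / 3 * R.Gfr 1 * U ^ 2 * 2 := by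
        rw [Finset.prod_const, Finset.card_univ, Fintype.card_fin, pow_one]
        exact mul_le_mul (hA _) norm_toLpCLM_le (norm_nonneg _) hA0
    _ = 8 / 3 * R.Gfr 1 * U ^ 2 := by ring

/-! ## §2 The frame-uniform Gauss-map rate of an admissible frame's level curves -/

section Frame

variable {a b : ℝ} (B : BandBounds a b) {R : RenConsts} (hR : R.WF2) {U : ℝ} {N : ℕ} {μ : ℝ} {K : TrigPolyC4v} (hK : FrameOK R U N μ K)
  {ν : ℝ} (hlo : a ≤ ν - 4 / 3 * R.Gfr 0 * |U|) (hhi : ν + 4 / 3 * R.Gfr 0 * |U| ≤ b) (hκ₁ : 8 / 3 * R.Gfr 1 * U ^ 2 < B.Dtmin)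
  (hν : |ν - μ| < 3 / 80)
include B hR hK hlo hhi hκ₁ hν

/-- **Pointwise rate under `FrameOK`**: for the canonical root selection `u = perturbedFermiRadius δ_K ν` of the level-`(ν − μ)` curve of `e_K`,
`α′(θ) ≥ u_min·(3/200)/(4 + (8/3)Gfr₁U²)` — independent of `N` and of the frame. [cite: FeldmanSalmhoferTrubowitz1998, Lemma 2.1] -/
theorem deriv_normalAngleFn_ge_of_frameOK (θ : ℝ) :
    B.umin * (3 / 200) / (4 + 8 / 3 * R.Gfr 1 * U ^ 2) ≤
      deriv (fun ϑ => ϑ - Real.arctan (deriv (perturbedFermiRadius (fun k : Fin 2 → ℝ => -K.eval k) ν) ϑ /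
        perturbedFermiRadius (fun k : Fin 2 → ℝ => -K.eval k) ν ϑ)) θ := by
  have hGfr := hR.wf.2.2
  have hδ := abs_negEval_le_of_frameOK hGfr hK
  have hκ := norm_fderiv_negEval_le_of_frameOK hGfr hK
  have hδc : Continuous (fun k : Fin 2 → ℝ => -K.eval k) := (contDiff_frameShift_toLp K (m := 0)).continuous
  have hu := isBandFermiRadius_perturbedFermiRadius B hδc (fun k _ => hδ k) hlo hhi
  exact deriv_normalAngleFn_ge_of_geomConstants B (fun k _ => hδ k) hlo hhi (fun k _ => hκ k) hκ₁ hu hK.1 hν θ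

/-- **Expanding Gauss map under `FrameOK`, real line**: `c_K·|θ − θ′| ≤ |α(θ) − α(θ′)|`, `c_K = u_min·(3/200)/(4 + (8/3)Gfr₁U²)`.
[cite: BenfattoGiulianiMastropietro2003, §7.1 Lemma 7.1 (A1.9)] -/
theorem normalAngleFn_expand_of_frameOK (θ θ' : ℝ) :
    B.umin * (3 / 200) / (4 + 8 / 3 * R.Gfr 1 * U ^ 2) * |θ - θ'| ≤
      |(θ - Real.arctan (deriv (perturbedFermiRadius (fun k : Fin 2 → ℝ => -K.eval k) ν) θ /
          perturbedFermiRadius (fun k : Fin 2 → ℝ => -K.eval k) ν θ)) -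
        (θ' - Real.arctan (deriv (perturbedFermiRadius (fun k : Fin 2 → ℝ => -K.eval k) ν) θ' /
          perturbedFermiRadius (fun k : Fin 2 → ℝ => -K.eval k) ν θ'))| := by
  have hGfr := hR.wf.2.2
  have hδ := abs_negEval_le_of_frameOK hGfr hK
  have hκ := norm_fderiv_negEval_le_of_frameOK hGfr hK
  have hδc : Continuous (fun k : Fin 2 → ℝ => -K.eval k) := (contDiff_frameShift_toLp K (m := 0)).continuous
  have hu := isBandFermiRadius_perturbedFermiRadius B hδc (fun k _ => hδ k) hlo hhi
  exact normalAngleFn_expand_of_geomConstants B (fun k _ => hδ k) hlo hhi (fun k _ => hκ k) hκ₁ hu hK.1 hν θ θ'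

/-- **Expanding Gauss map under `FrameOK`, torus**: `c_K·‖θ − θ′‖_𝕋 ≤ ‖α(θ) − α(θ′)‖_𝕋` — the injectivity modulus of the normal direction of every admissible
frame's thin-shell level curve, uniformly in `N` and in the frame. [cite: BenfattoGiulianiMastropietro2003, §7.1 Lemma 7.1 (A1.9)] -/
theorem torusDist_normalAngleFn_sub_ge_of_frameOK (θ θ' : ℝ) :
    B.umin * (3 / 200) / (4 + 8 / 3 * R.Gfr 1 * U ^ 2) * torusDist (θ - θ') ≤
      torusDist ((θ - Real.arctan (deriv (perturbedFermiRadius (fun k : Fin 2 → ℝ => -K.eval k) ν) θ /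
          perturbedFermiRadius (fun k : Fin 2 → ℝ => -K.eval k) ν θ)) -
        (θ' - Real.arctan (deriv (perturbedFermiRadius (fun k : Fin 2 → ℝ => -K.eval k) ν) θ' /
          perturbedFermiRadius (fun k : Fin 2 → ℝ => -K.eval k) ν θ'))) := by
  have hGfr := hR.wf.2.2
  have hδ := abs_negEval_le_of_frameOK hGfr hK
  have hκ := norm_fderiv_negEval_le_of_frameOK hGfr hK
  have hδc : Continuous (fun k : Fin 2 → ℝ => -K.eval k) := (contDiff_frameShift_toLp K (m := 0)).continuous
  have hu := isBandFermiRadius_perturbedFermiRadius B hδc (fun k _ => hδ k) hlo hhi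
  exact torusDist_normalAngleFn_sub_ge_of_geomConstants B (fun k _ => hδ k) hlo hhi (fun k _ => hκ k) hκ₁ hK.1 hν hu
    (fun θ => perturbedFermiRadius_add_two_pi _ ν θ) θ θ'

end Frame

end Summit.HubbardSuperconductivity.HubbardSuperconductivity.Theorems.PerturbedFermiCurve

end
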